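import Literature.NumberTheory.Sieve.HardyLittlewoodChowlaMomentsPrep
import Literature.NumberTheory.Sieve.HardyLittlewoodChowlaTuples
import HarnessLib

/-!
# Hardy–Littlewood–Chowla on average (Lichtman–Teräväinen 2022): Proposition 2.7, the moment bound

Topic `Literature/NumberTheory/Sieve`, companion of `HardyLittlewoodChowla.lean` (the named facts
`lichtmanTeravainen2022_hlc_avg(_liouville)` = J. D. Lichtman, J. Teräväinen, *On the
Hardy–Littlewood–Chowla conjecture on average*, Forum Math. Sigma 10 (2022) e57,
doi:10.1017/fms.2022.54, arXiv:2111.08912 [LichtmanTeravainen2022], Theorem 1.2 (i)), built on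
`HardyLittlewoodChowlaMomentsPrep.lean` (the expansion of the moment, the passage from windows to
a base point and an offset pattern, the crude uniform prime-tuple bound) and
`HardyLittlewoodChowlaTuples.lean` (leaders and the count of balanced pinned patterns).
Everything in this file is PROVED; it introduces no definition and no named fact.

Main result `moment_bound` — **Proposition 2.7 of the paper in the discrete all-windows form**
consumed by the Fourier argument (hypothesis `hA₁` of `holder_fourier_bound`, hypothesis `hM` of
`hlc_avg_core` / `hlc_avg_moebius_of_moments` in `HardyLittlewoodChowlaAssembly.lean`): for a finite
`A ⊂ ℕ_{≥ 1}` with `ℓ = #A` and `ε > 0` there are `j ≥ 2`, `C₀`, `B`, `X₁` with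
`∫₀¹ ∑_{k ≤ X+2H} |∑_{n ∈ (k−2H,k], n ≤ X} b(n) ∏_{a∈A} Λ(n+a) e(−nα)|^{2j} dα
  ≤ B (log log X)^{C₀} (2H)^{2j−1} (X+2H)` for `X ≥ X₁`, `(log X)^{ℓ+ε} ≤ H ≤ X`, `|b| ≤ 1`
(held copy `paper:arxiv-2111.08912`, pp. 8–9: "`∫₀¹ |∑_{x≤n≤x+H} b_n e(nα) ∏ Λ(n+hᵢ)|^{2k} dα
≪ H^{2k−1}(log X)^{kℓ−ℓ⌈m/ℓ⌉+1_{m>(k−1)ℓ}} … ≪ H^{2k−1}` provided `H ≥ (log X)^{ℓ+ε}`,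
`k ≥ ℓ(1 + 1/ε)`").  We allow the factor `(log log X)^{C₀}` (`C₀ = 2jℓ`), which the deduction of
Theorem 1.2 (i) absorbs, and accordingly use the crude bound `sum_prod_vonMangoldt_le_of_card_image`
in place of Lemma 2.4; the combinatorics (`s ≥ ℓ·#leaders` distinct shifts, `≪ H^{c−1−𝟙[c>j]}`
patterns with `c` leaders, `j ≥ 1 + ℓ/ε`) is the paper's.

* `sum_pattern_rebase_le`, `sum_pattern_le` — one offset pattern: re-base at the lowest entry and
  apply the tuple bound, `≪ N (log log N)^M (log N)^{M−s}`;
* `card_patterns_le` — patterns with `c` leaders, from `card_pinned_balanced_le`;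
* `count_weight_le` — the exponent bookkeeping `(4H)^{c−1−𝟙} (log X)^{ℓ(2j−c)} ≤ 4^{2j} H^{2j−2}`;
* `sum_balanced_shift_le`, `continuous_windowSum` — shifting the weight by `2H` into the support
  convention of `sum_windows_le_line`; `moment_bound` — the assembly.

## References

* J. D. Lichtman, J. Teräväinen, Forum Math. Sigma 10 (2022) e57, arXiv:2111.08912, §2.2,
  Proposition 2.7 and its proof, displays (2.7)–(2.9). [cite: LichtmanTeravainen2022, Proposition 2.7]
-/

noncomputable section

open Finset Real MeasureTheory
open scoped FourierTransform ArithmeticFunction.vonMangoldt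

namespace Literature.NumberTheory.Sieve

namespace LichtmanTeravainen2022

/-! ### Re-basing a pattern sum at its lowest entry -/

/-- For a pattern `z` with lowest entry `z i₀ ≤ 2H` and `F ≥ 0`:
`∑_{n ≤ N} ∏ᵢ 𝟙[n + zᵢ > 2H] F(n + zᵢ − 2H) ≤ ∑_{n₀ ≤ N} ∏ᵢ F(n₀ + (zᵢ − z_{i₀}))`
(the terms with `n + z_{i₀} ≤ 2H` vanish; on the others `n ↦ n + z_{i₀} − 2H` is injective into
`[0, N]`). [folklore] -/
theorem sum_pattern_rebase_le (N H : ℕ) (F : ℕ → ℝ) (hF : ∀ n, 0 ≤ F n) {m : ℕ} (z : Fin m → ℕ)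
    (i₀ : Fin m) (hi₀ : ∀ i, z i₀ ≤ z i) (hzH : z i₀ ≤ 2 * H) :
    ∑ n ∈ range (N + 1), ∏ i, (if 2 * H < n + z i then F (n + z i - 2 * H) else 0) ≤
      ∑ n₀ ∈ range (N + 1), ∏ i, F (n₀ + (z i - z i₀)) := by
  classical
  set good : Finset ℕ := (range (N + 1)).filter fun n => 2 * H < n + z i₀ with hgood
  have hsplit : ∑ n ∈ range (N + 1), ∏ i, (if 2 * H < n + z i then F (n + z i - 2 * H) else 0) =
      ∑ n ∈ good, ∏ i, F (n + z i - 2 * H) := by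
    rw [hgood, Finset.sum_filter]
    refine Finset.sum_congr rfl fun n _ => ?_
    split_ifs with h
    · refine Finset.prod_congr rfl fun i _ => ?_
      rw [if_pos (lt_of_lt_of_le h (by have := hi₀ i; omega))]
    · exact Finset.prod_eq_zero (Finset.mem_univ i₀) (if_neg h)
  rw [hsplit]
  refine sum_le_sum_of_injOn_nn good (range (N + 1)) (fun n => n + z i₀ - 2 * H)
    (fun n => ∏ i, F (n + z i - 2 * H)) (fun n₀ => ∏ i, F (n₀ + (z i - z i₀))) ?_ ?_
    (fun n₀ _ => Finset.prod_nonneg fun i _ => hF _) ?_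
  · intro n hn n' hn' h
    have h1 := (Finset.mem_filter.1 hn).2
    have h2 := (Finset.mem_filter.1 hn').2
    simp only at h
    omega
  · intro n hn
    have h1 := Finset.mem_range.1 (Finset.mem_filter.1 hn).1
    rw [Finset.mem_range]; omega
  · intro n hn
    have h1 := (Finset.mem_filter.1 hn).2
    refine le_of_eq (Finset.prod_congr rfl fun i _ => ?_)
    congr 1
    have := hi₀ i
    omega

/-- Splitting a product over `Fin j × A`-indexed shifts along a pattern: with
`F(r) = ∏_{a ∈ A} Λ(r + a)`, `∏ᵢ F(n₀ + uᵢ) = ∏_{(i, a) ∈ Fin m × A} Λ(n₀ + (uᵢ + a))`. [folklore] -/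
theorem prod_prod_vonMangoldt_eq {m : ℕ} (A : Finset ℕ) (u : Fin m → ℕ) (n₀ : ℕ) :
    ∏ i, ∏ a ∈ A, Λ (n₀ + u i + a) = ∏ q : Fin m × A, (Λ (n₀ + (u q.1 + (q.2 : ℕ))) : ℝ) := by
  rw [Fintype.prod_prod_type]
  refine Finset.prod_congr rfl fun i _ => ?_
  rw [← Finset.prod_coe_sort A]
  refine Finset.prod_congr rfl fun a _ => ?_
  rw [add_assoc]

/-- The number of distinct shifts `uᵢ + a` of a re-based pattern equals that of the pattern
(`u = z − z_{i₀}`), and as integers. [folklore] -/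
theorem card_image_shifts_eq {m : ℕ} (A : Finset ℕ) (z : Fin m → ℕ) (i₀ : Fin m)
    (hi₀ : ∀ i, z i₀ ≤ z i) :
    #(univ.image fun q : Fin m × A => z q.1 - z i₀ + (q.2 : ℕ)) =
      #((univ ×ˢ (A.map Nat.castEmbedding)).image fun p : Fin m × ℤ => (z p.1 : ℤ) + p.2) := by
  classical
  -- both are images of `univ × A` under maps that differ by an injection
  have h1 : (univ.image fun q : Fin m × A => z q.1 - z i₀ + (q.2 : ℕ)) =
      ((univ ×ˢ A).image fun p : Fin m × ℕ => z p.1 - z i₀ + p.2) := by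
    ext t
    simp only [Finset.mem_image, Finset.mem_univ, true_and, Finset.mem_product, Prod.exists,
      Subtype.exists, exists_prop]
  have h2 : ((univ ×ˢ (A.map Nat.castEmbedding)).image fun p : Fin m × ℤ => (z p.1 : ℤ) + p.2) =
      ((univ ×ˢ A).image fun p : Fin m × ℕ => z p.1 - z i₀ + p.2).map
        ⟨fun t : ℕ => (t : ℤ) + z i₀, fun a b h => by simpa using h⟩ := by
    ext t
    simp only [Finset.mem_image, Finset.mem_product, Finset.mem_univ, true_and, Finset.mem_map,
      Function.Embedding.coeFn_mk, Prod.exists, Nat.castEmbedding_apply]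
    constructor
    · rintro ⟨i, b, ⟨a, ha, rfl⟩, rfl⟩
      refine ⟨z i - z i₀ + a, ⟨i, a, ha, rfl⟩, ?_⟩
      have := hi₀ i
      push_cast [Nat.cast_sub this]
      ring
    · rintro ⟨t, ⟨i, a, ha, rfl⟩, rfl⟩
      refine ⟨i, (a : ℤ), ⟨a, ha, rfl⟩, ?_⟩
      have := hi₀ i
      push_cast [Nat.cast_sub this]
      ring
  rw [h1, h2, Finset.card_map]

/-- **One pattern** (display (2.9) of the paper for a fixed offset pattern): for every `M` there are
`C ≥ 0`, `X₀` such that for `N ≥ X₀`, a set `A` of shifts and a pattern `z : Fin m → ℕ` with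
`m · #A = M`, lowest entry `z_{i₀} ≤ 2H` and `zᵢ + a ≤ N + z_{i₀}`,
`∑_{n ≤ N} ∏ᵢ 𝟙[n + zᵢ > 2H] ∏_{a∈A} Λ(n + zᵢ − 2H + a) ≤ C N (log log N)^M (log N)^{M − s}`, where
`s = #{zᵢ + a}` is the number of distinct shifts. [cite: LichtmanTeravainen2022, Proposition 2.7 (proof)] -/
theorem sum_pattern_le (M : ℕ) : ∃ (C : ℝ) (X₀ : ℕ), 0 ≤ C ∧ ∀ (N H : ℕ) (A : Finset ℕ) {m : ℕ}
    (z : Fin m → ℕ) (i₀ : Fin m), X₀ ≤ N → m * #A = M → (∀ i, z i₀ ≤ z i) → z i₀ ≤ 2 * H →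
    (∀ a ∈ A, 1 ≤ a) → (∀ i, ∀ a ∈ A, z i + a ≤ N + z i₀) →
    ∑ n ∈ range (N + 1), ∏ i, (if 2 * H < n + z i then ∏ a ∈ A, Λ (n + z i - 2 * H + a) else 0) ≤
      C * N * Real.log (Real.log N) ^ M *
        Real.log N ^ (M - #((univ ×ˢ (A.map Nat.castEmbedding)).image
          fun p : Fin m × ℤ => (z p.1 : ℤ) + p.2)) := by
  classical
  obtain ⟨C, X₀, hC, h⟩ := sum_prod_vonMangoldt_le_of_card_image M
  refine ⟨C, X₀, hC, fun N H A m z i₀ hN hM hi₀ hzH hA hzN => ?_⟩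
  have h1 := sum_pattern_rebase_le N H (fun r => ∏ a ∈ A, Λ (r + a))
    (fun r => Finset.prod_nonneg fun a _ => ArithmeticFunction.vonMangoldt_nonneg) z i₀ hi₀ hzH
  refine h1.trans ?_
  have h2 : ∀ n₀, ∏ i, ∏ a ∈ A, Λ (n₀ + (z i - z i₀) + a) =
      ∏ q : Fin m × A, (Λ (n₀ + (z q.1 - z i₀ + (q.2 : ℕ))) : ℝ) := fun n₀ =>
    prod_prod_vonMangoldt_eq A (fun i => z i - z i₀) n₀
  simp_rw [h2]
  have hcard : Fintype.card (Fin m × A) = M := by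
    rw [Fintype.card_prod, Fintype.card_fin, Fintype.card_coe, hM]
  have hy : ∀ q : Fin m × A, 1 ≤ z q.1 - z i₀ + (q.2 : ℕ) ∧ z q.1 - z i₀ + (q.2 : ℕ) ≤ N := by
    intro q
    have ha := hA q.2 q.2.2
    have hb := hzN q.1 q.2 q.2.2
    have hc := hi₀ q.1
    constructor <;> omega
  have h3 := h N hN (fun q : Fin m × A => z q.1 - z i₀ + (q.2 : ℕ)) hcard hy
  rw [card_image_shifts_eq A z i₀ hi₀] at h3
  exact h3


/-! ### Counting offset patterns by their number of leaders -/

/-- The sign vector `(1,…,1,−1,…,−1)` on `Fin (j + j)`. [folklore] -/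
theorem sgn_aux (j : ℕ) : ∀ i : Fin (j + j),
    Fin.append (fun _ : Fin j => (1 : ℤ)) (fun _ : Fin j => (-1 : ℤ)) i = 1 ∨
      Fin.append (fun _ : Fin j => (1 : ℤ)) (fun _ : Fin j => (-1 : ℤ)) i = -1 := by
  intro i
  refine Fin.addCases (fun i => ?_) (fun i => ?_) i
  · left; rw [Fin.append_left]
  · right; rw [Fin.append_right]

/-- `∑ᵢ sᵢ = 0` for the sign vector. [folklore] -/
theorem sum_sgn_aux (j : ℕ) :
    ∑ i, Fin.append (fun _ : Fin j => (1 : ℤ)) (fun _ : Fin j => (-1 : ℤ)) i = 0 := by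
  rw [Fin.sum_univ_add]
  simp only [Fin.append_left, Fin.append_right, Finset.sum_const, Finset.card_univ,
    Fintype.card_fin]
  ring

/-- A balanced pair `(e, e')` gives a vector `x = (e, e')` with `∑ sᵢ xᵢ = 0`. [folklore] -/
theorem sum_sgn_mul_append {j : ℕ} (e e' : Fin j → ℕ) (h : ∑ i, e i = ∑ i, e' i) :
    ∑ i, Fin.append (fun _ : Fin j => (1 : ℤ)) (fun _ : Fin j => (-1 : ℤ)) i *
      ((Fin.append e e' i : ℕ) : ℤ) = 0 := by
  rw [Fin.sum_univ_add]
  simp only [Fin.append_left, Fin.append_right, one_mul, neg_mul, Finset.sum_neg_distrib]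
  have : ((∑ i, e i : ℕ) : ℤ) = ((∑ i, e' i : ℕ) : ℤ) := by exact_mod_cast h
  push_cast at this
  linarith

/-- **The number of balanced offset patterns with `c` leaders** (from `card_pinned_balanced_le`):
with `m = 2j`, the pairs `(e, e') ∈ [1, 4H−1]^j × [1, 4H−1]^j` with `∑ eᵢ = ∑ e'ᵢ`, `e'_{j} = 2H`
whose concatenation has exactly `c` leaders at distance `D` number `≤ C (4H)^{c−1−𝟙[m<2c]}`.
[cite: LichtmanTeravainen2022, Proposition 2.7 (proof)] -/
theorem card_patterns_le (j : ℕ) (hj : 1 ≤ j) {D : ℤ} (hD : 0 ≤ D) :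
    ∃ C : ℕ, ∀ (H c : ℕ),
      #((((Fintype.piFinset fun _ : Fin j => Icc 1 (4 * H - 1)) ×ˢ
          (Fintype.piFinset fun _ : Fin j => Icc 1 (4 * H - 1))).filter
            (fun e => ∑ i, e.1 i = ∑ i, e.2 i ∧ e.2 ⟨j - 1, by omega⟩ = 2 * H)).filter
          fun e => #(leaders D (fun k => ((Fin.append e.1 e.2 k : ℕ) : ℤ))) = c) ≤
        C * (4 * H) ^ (c - 1 - if j + j < 2 * c then 1 else 0) := by
  classical
  set sgn : Fin (j + j) → ℤ := Fin.append (fun _ : Fin j => (1 : ℤ)) (fun _ : Fin j => (-1 : ℤ))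
    with hsgn
  set ilast : Fin (j + j) := Fin.natAdd j ⟨j - 1, by omega⟩ with hilast
  have hlast : ∀ i : Fin (j + j), i ≤ ilast := by
    intro i
    rw [Fin.le_def, hilast]
    simp only [Fin.natAdd_mk]
    have := i.2
    omega
  obtain ⟨C, hC⟩ := card_pinned_balanced_le (j + j) hD sgn (sgn_aux j) (sum_sgn_aux j) ilast hlast
  refine ⟨C, fun H c => ?_⟩
  rcases Nat.eq_zero_or_pos H with hH0 | hH0
  · -- `H = 0`: the box is empty
    subst hH0
    refine le_of_eq_of_le (Finset.card_eq_zero.2 (Finset.filter_eq_empty_iff.2 fun e he => ?_))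
      (Nat.zero_le _)
    have he' := (Finset.mem_filter.1 he).1
    simp only [Finset.mem_product, Fintype.mem_piFinset, Finset.mem_Icc] at he'
    have := he'.1 ⟨0, hj⟩
    omega
  have h1 := hC (4 * H - 1) ((2 * H : ℕ) : ℤ) c
  rw [Nat.sub_add_cancel (by omega : 1 ≤ 4 * H)] at h1
  refine le_trans ?_ h1
  · -- injection `(e, e') ↦ x`
    refine Finset.card_le_card_of_injOn (fun e => fun k => ((Fin.append e.1 e.2 k : ℕ) : ℤ))
      (fun e he => ?_) ?_
    · rw [Finset.mem_coe, Finset.mem_filter] at he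
      obtain ⟨he, hc⟩ := he
      rw [Finset.mem_filter] at he
      obtain ⟨hbox, hbal, hpin⟩ := he
      simp only [Finset.mem_product, Fintype.mem_piFinset, Finset.mem_Icc] at hbox
      rw [Finset.mem_coe, Finset.mem_filter]
      refine ⟨?_, ?_, ?_, hc⟩
      · rw [Fintype.mem_piFinset]
        intro k
        rw [Finset.mem_Icc]
        refine Fin.addCases (fun i => ?_) (fun i => ?_) k
        · show 1 ≤ ((Fin.append e.1 e.2 (Fin.castAdd j i) : ℕ) : ℤ) ∧
            ((Fin.append e.1 e.2 (Fin.castAdd j i) : ℕ) : ℤ) ≤ ((4 * H - 1 : ℕ) : ℤ)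
          rw [Fin.append_left]
          have := hbox.1 i
          exact ⟨by exact_mod_cast this.1, by exact_mod_cast this.2⟩
        · show 1 ≤ ((Fin.append e.1 e.2 (Fin.natAdd j i) : ℕ) : ℤ) ∧
            ((Fin.append e.1 e.2 (Fin.natAdd j i) : ℕ) : ℤ) ≤ ((4 * H - 1 : ℕ) : ℤ)
          rw [Fin.append_right]
          have := hbox.2 i
          exact ⟨by exact_mod_cast this.1, by exact_mod_cast this.2⟩
      · rw [hsgn]; exact sum_sgn_mul_append e.1 e.2 hbal
      · show ((Fin.append e.1 e.2 ilast : ℕ) : ℤ) = ((2 * H : ℕ) : ℤ)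
        rw [hilast, Fin.append_right, hpin]
    · intro e _ e' _ h
      simp only at h
      have h' : ∀ k, Fin.append e.1 e.2 k = Fin.append e'.1 e'.2 k := fun k => by
        have := congrFun h k
        exact_mod_cast this
      refine Prod.ext (funext fun i => ?_) (funext fun i => ?_)
      · have := h' (Fin.castAdd j i)
        rwa [Fin.append_left, Fin.append_left] at this
      · have := h' (Fin.natAdd j i)
        rwa [Fin.append_right, Fin.append_right] at this

/-- The last index is always a leader, so every pattern has between `1` and `m` leaders.
[folklore] -/
theorem card_leaders_mem_Icc {m : ℕ} (hm : 1 ≤ m) (D : ℤ) (x : Fin m → ℤ) :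
    #(leaders D x) ∈ Icc 1 m := by
  rw [Finset.mem_Icc]
  constructor
  · refine Finset.card_pos.2 ⟨⟨m - 1, by omega⟩, mem_leaders_of_forall_le fun i => ?_⟩
    rw [Fin.le_def]
    have := i.2
    simp only
    omega
  · exact (Finset.card_le_univ _).trans (by rw [Fintype.card_fin])

/-- **The exponent bookkeeping** of the proof of Proposition 2.7: for `1 ≤ c ≤ 2j`,
`ℓ ≤ ε (j − 1)`, `t ≥ 1`, `H ≥ 1`, `t^{ℓ+ε} ≤ H`:
`(4H)^{c−1−𝟙[2j<2c]} t^{ℓ(2j−c)} ≤ 4^{2j} H^{2j−2}`. [cite: LichtmanTeravainen2022, Proposition 2.7 (proof)] -/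
theorem count_weight_le {ℓ j c : ℕ} {ε t H : ℝ} (hε : 0 < ε) (hjε : (ℓ : ℝ) ≤ ε * ((j : ℝ) - 1))
    (hc1 : 1 ≤ c) (hcm : c ≤ j + j) (ht : 1 ≤ t) (hH : 1 ≤ H) (htH : t ^ ((ℓ : ℝ) + ε) ≤ H) :
    (4 * H) ^ (c - 1 - if j + j < 2 * c then 1 else 0) * t ^ (ℓ * (j + j - c)) ≤
      4 ^ (j + j) * H ^ (j + j - 2) := by
  have hκ : 0 < (ℓ : ℝ) + ε := by positivity
  have ht0 : 0 ≤ t := by linarith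
  -- the exponent `p = c - 1 - δ` and the complementary exponent `q = 2j - 2 - p`
  set δ : ℕ := if j + j < 2 * c then 1 else 0 with hδ
  set p : ℕ := c - 1 - δ with hp
  have hj1 : 1 ≤ j := by omega
  have hpm : p ≤ j + j - 2 := by
    rw [hp, hδ]; split_ifs with h <;> omega
  set q : ℕ := j + j - 2 - p with hq
  -- the real exponent inequality `ℓ (2j - c) ≤ (ℓ + ε) q`
  have hexp : ((ℓ * (j + j - c) : ℕ) : ℝ) ≤ ((ℓ : ℝ) + ε) * (q : ℝ) := by
    by_cases hcj : c ≤ j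
    · have hδ0 : δ = 0 := by rw [hδ]; rw [if_neg (by omega)]
      have hq' : q = j + j - 1 - c := by rw [hq, hp, hδ0]; omega
      have hq2 : ((q : ℕ) : ℝ) = (j : ℝ) + j - 1 - c := by
        rw [hq']; push_cast [Nat.cast_sub (by omega : c ≤ j + j - 1), Nat.cast_sub (by omega : 1 ≤ j + j)]; ring
      have hmc : (((j + j - c : ℕ)) : ℝ) = (j : ℝ) + j - c := by
        push_cast [Nat.cast_sub (by omega : c ≤ j + j)]; ring
      push_cast
      rw [hmc, hq2]
      have hcj' : (c : ℝ) ≤ j := by exact_mod_cast hcj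
      nlinarith
    · push Not at hcj
      have hδ1 : δ = 1 := by rw [hδ]; rw [if_pos (by omega)]
      have hq' : q = j + j - c := by rw [hq, hp, hδ1]; omega
      rw [hq']
      push_cast [Nat.cast_sub hcm]
      nlinarith [(Nat.cast_nonneg c : (0:ℝ) ≤ c), (show (c : ℝ) ≤ j + j by exact_mod_cast hcm)]
  -- `t^{ℓ(2j-c)} ≤ H^q`
  have h1 : t ^ (ℓ * (j + j - c)) ≤ H ^ q := by
    calc t ^ (ℓ * (j + j - c)) = t ^ (((ℓ * (j + j - c) : ℕ)) : ℝ) := (Real.rpow_natCast _ _).symm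
      _ ≤ t ^ (((ℓ : ℝ) + ε) * (q : ℝ)) := Real.rpow_le_rpow_of_exponent_le ht hexp
      _ = (t ^ ((ℓ : ℝ) + ε)) ^ q := by rw [Real.rpow_mul ht0, Real.rpow_natCast]
      _ ≤ H ^ q := pow_le_pow_left₀ (Real.rpow_nonneg ht0 _) htH q
  -- combine
  have hpq : p + q = j + j - 2 := by rw [hq]; omega
  calc (4 * H) ^ p * t ^ (ℓ * (j + j - c)) ≤ (4 * H) ^ p * H ^ q :=
        mul_le_mul_of_nonneg_left h1 (by positivity)
    _ = 4 ^ p * H ^ (p + q) := by rw [mul_pow, pow_add]; ring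
    _ ≤ 4 ^ (j + j) * H ^ (p + q) := by
        refine mul_le_mul_of_nonneg_right (pow_le_pow_right₀ (by norm_num) (by omega)) (by positivity)
    _ = 4 ^ (j + j) * H ^ (j + j - 2) := by rw [hpq]


/-! ### Proposition 2.7 (discrete form): the `2j`-th moment over all windows -/

/-- Continuity of a window sum `α ↦ ∑_{n ∈ W} c(n) e(−nα)`. [folklore] -/
theorem continuous_windowSum (W : Finset ℕ) (c : ℕ → ℂ) :
    Continuous fun α : ℝ => ∑ n ∈ W, c n * (𝐞 (-((n : ℝ) * α)) : ℂ) :=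
  continuous_finsetSum W fun _ _ => continuous_const.mul
    (continuous_subtype_val.comp (Real.continuous_fourierChar.comp
      ((continuous_const.mul continuous_id).neg)))

/-- Shifting a window's balanced tuples up by `2H`: with `v₂(m) = 𝟙[m > 2H] v₁(m − 2H)`,
`∑_{(t,t') ∈ W_k^j × W_k^j, bal} ∏ v₁ ∏ v₁ ≤ ∑_{(t,t') ∈ W_{k+2H}^j × W_{k+2H}^j, bal} ∏ v₂ ∏ v₂`
(`W_k = (k − 2H, k]`; the map `t ↦ t + 2H` is injective and preserves balance). [folklore] -/
theorem sum_balanced_shift_le (k H j : ℕ) (v₁ : ℕ → ℝ) (hv : ∀ n, 0 ≤ v₁ n) :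
    ∑ p ∈ ((Fintype.piFinset fun _ : Fin j => Ioc (k - 2 * H) k) ×ˢ
        (Fintype.piFinset fun _ : Fin j => Ioc (k - 2 * H) k)).filter
          (fun p => ∑ i, p.1 i = ∑ i, p.2 i),
      (∏ i, v₁ (p.1 i)) * ∏ i, v₁ (p.2 i) ≤
    ∑ p ∈ ((Fintype.piFinset fun _ : Fin j => Ioc (k + 2 * H - 2 * H) (k + 2 * H)) ×ˢ
        (Fintype.piFinset fun _ : Fin j => Ioc (k + 2 * H - 2 * H) (k + 2 * H))).filter
          (fun p => ∑ i, p.1 i = ∑ i, p.2 i),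
      (∏ i, (if 2 * H < p.1 i then v₁ (p.1 i - 2 * H) else 0)) *
        ∏ i, (if 2 * H < p.2 i then v₁ (p.2 i - 2 * H) else 0) := by
  classical
  have hv₂ : ∀ m, 0 ≤ (if 2 * H < m then v₁ (m - 2 * H) else 0) := fun m => by
    split_ifs
    · exact hv _
    · exact le_rfl
  refine sum_le_sum_of_injOn_nn _ _ (fun p => (fun i => p.1 i + 2 * H, fun i => p.2 i + 2 * H))
    _ _ ?_ ?_ (fun p _ => mul_nonneg (Finset.prod_nonneg fun i _ => hv₂ _)
      (Finset.prod_nonneg fun i _ => hv₂ _)) ?_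
  · intro p _ p' _ h
    simp only [Prod.mk.injEq] at h
    obtain ⟨h1, h2⟩ := h
    refine Prod.ext (funext fun i => ?_) (funext fun i => ?_)
    · exact Nat.add_right_cancel (congrFun h1 i)
    · exact Nat.add_right_cancel (congrFun h2 i)
  · intro p hp
    rw [Finset.mem_filter] at hp
    obtain ⟨hp, hbal⟩ := hp
    simp only [Finset.mem_product, Fintype.mem_piFinset, Finset.mem_Ioc] at hp
    rw [Finset.mem_filter]
    refine ⟨?_, ?_⟩
    · simp only [Finset.mem_product, Fintype.mem_piFinset, Finset.mem_Ioc]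
      refine ⟨fun i => ?_, fun i => ?_⟩
      · show k + 2 * H - 2 * H < p.1 i + 2 * H ∧ p.1 i + 2 * H ≤ k + 2 * H
        have := hp.1 i; constructor <;> omega
      · show k + 2 * H - 2 * H < p.2 i + 2 * H ∧ p.2 i + 2 * H ≤ k + 2 * H
        have := hp.2 i; constructor <;> omega
    · simp only [Finset.sum_add_distrib, Finset.sum_const, Finset.card_univ, Fintype.card_fin,
        smul_eq_mul, hbal]
  · intro p hp
    rw [Finset.mem_filter] at hp
    simp only [Finset.mem_product, Fintype.mem_piFinset, Finset.mem_Ioc] at hp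
    refine le_of_eq ?_
    dsimp only
    congr 1
    · refine Finset.prod_congr rfl fun i _ => ?_
      have := (hp.1.1 i).1
      rw [if_pos (show 2 * H < p.1 i + 2 * H by omega), Nat.add_sub_cancel]
    · refine Finset.prod_congr rfl fun i _ => ?_
      have := (hp.1.2 i).1
      rw [if_pos (show 2 * H < p.2 i + 2 * H by omega), Nat.add_sub_cancel]

/-- Splitting a product over `Fin (j + j)` along `Fin.append`. [folklore] -/
theorem prod_append_eq {j : ℕ} (e e' : Fin j → ℕ) (g : ℕ → ℝ) :
    ∏ k : Fin (j + j), g (Fin.append e e' k) = (∏ i, g (e i)) * ∏ i, g (e' i) := by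
  rw [Fin.prod_univ_add]
  simp only [Fin.append_left, Fin.append_right]

set_option maxHeartbeats 1600000 in
/-- **Proposition 2.7 of [LichtmanTeravainen2022], discrete all-windows form** (the `𝖧₁` input of
the Fourier argument, hypothesis `hA₁` of `holder_fourier_bound` / `hM` of `hlc_avg_core`): for a
finite set `A ⊂ ℕ_{≥1}` of `ℓ` shifts and `ε > 0` there are `j ≥ 2`, `C₀`, `B`, `X₁` such that for
`X ≥ X₁`, `(log X)^{ℓ+ε} ≤ H ≤ X` and every `1`-bounded `b`,
`∫₀¹ ∑_{k ≤ X+2H} |∑_{n ∈ (k−2H, k], n ≤ X} b(n) ∏_{a∈A} Λ(n+a) e(−nα)|^{2j} dα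
  ≤ B (log log X)^{C₀} (2H)^{2j−1} (X + 2H)`.
The paper proves `≪ H^{2j−1} X` without the `log log` factor via Lemma 2.4; this form (with
`C₀ = 2jℓ`, from the crude uniform tuple bound `sum_prod_vonMangoldt_le_of_card_image`) is what
the deduction of Theorem 1.2 (i) consumes.  Proof as in the paper: expand the moment
(`integral_norm_pow_le_sum_balanced`), pass to a base point and a balanced offset pattern
(`sum_windows_le_line`), bound each pattern sum by `X (log log X)^{2jℓ} (log X)^{2jℓ − s}` with
`s ≥ ℓ · #leaders` distinct shifts (`sum_pattern_le`, `card_mul_card_leaders_le`), and count the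
patterns with `c` leaders (`card_patterns_le`: `≪ H^{c−1−𝟙[c>j]}`), the choice `j ≥ 1 + ℓ/ε`
making `(log X)^{(2j−c)ℓ} H^{c−1−𝟙[c>j]} ≤ 4^{2j} H^{2j−2}` (`count_weight_le`).
[cite: LichtmanTeravainen2022, Proposition 2.7] -/
theorem moment_bound (A : Finset ℕ) (ε : ℝ) (hε : 0 < ε) (hA : ∀ a ∈ A, 1 ≤ a) :
    ∃ (j C₀ : ℕ) (B X₁ : ℝ), 2 ≤ j ∧ ∀ (X H : ℕ), X₁ ≤ (X : ℝ) →
      Real.log X ^ ((#A : ℝ) + ε) ≤ H → (H : ℝ) ≤ X → ∀ b : ℕ → ℂ, (∀ n, ‖b n‖ ≤ 1) →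
      ∫ α in (0 : ℝ)..1, ∑ k ∈ Icc 1 (X + 2 * H),
        ‖∑ n ∈ Ioc (k - 2 * H) k,
          (if n ∈ Icc 1 X then b n * ∏ a ∈ A, (Λ (n + a) : ℂ) else 0) *
            (𝐞 (-((n : ℝ) * α)) : ℂ)‖ ^ (2 * j) ≤
        B * Real.log (Real.log X) ^ C₀ * ((2 * H : ℕ) : ℝ) ^ (2 * j - 1) * ((X + 2 * H : ℕ) : ℝ) := by
  classical
  -- parameters
  set ℓ : ℕ := #A with hℓ
  set j : ℕ := ⌈(ℓ : ℝ) / ε⌉₊ + 2 with hj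
  have hj2 : 2 ≤ j := by rw [hj]; omega
  have hj1 : 1 ≤ j := by omega
  set m : ℕ := j + j with hm
  set M : ℕ := m * ℓ with hM
  set D : ℕ := A.sup id with hD
  have hAD : ∀ a ∈ A, a ≤ D := fun a ha => by rw [hD]; exact Finset.le_sup (f := id) ha
  set Aℤ : Finset ℤ := A.map Nat.castEmbedding with hAℤ
  have hAℤcard : #Aℤ = ℓ := by rw [hAℤ, Finset.card_map]
  have hAℤD : ∀ a ∈ Aℤ, ∀ a' ∈ Aℤ, |a - a'| ≤ (D : ℤ) := by
    intro a ha a' ha'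
    rw [hAℤ, Finset.mem_map] at ha ha'
    obtain ⟨a, ha, rfl⟩ := ha
    obtain ⟨a', ha', rfl⟩ := ha'
    simp only [Nat.castEmbedding_apply]
    have h1 := hAD a ha
    have h2 := hAD a' ha'
    rw [abs_le]; constructor <;> omega
  have hjε : (ℓ : ℝ) ≤ ε * ((j : ℝ) - 1) := by
    have h1 : (ℓ : ℝ) / ε ≤ ⌈(ℓ : ℝ) / ε⌉₊ := Nat.le_ceil _
    have h2 : ((j : ℕ) : ℝ) = (⌈(ℓ : ℝ) / ε⌉₊ : ℝ) + 2 := by rw [hj]; push_cast; ring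
    rw [h2]
    rw [div_le_iff₀ hε] at h1
    nlinarith
  -- constants
  obtain ⟨Cc, X₀c, hCc, hcrude⟩ := sum_pattern_le M
  obtain ⟨CT, hCT⟩ := card_patterns_le j hj1 (D := (D : ℤ)) (by positivity)
  set B : ℝ := 8 * Cc * m * CT * 4 ^ M * 4 ^ m + 1 with hB
  refine ⟨j, M, B, max (X₀c : ℝ) (max (D : ℝ) 16), hj2, ?_⟩
  intro X H hX hHlow hHX b hb
  -- ranges
  have hXc : (X₀c : ℝ) ≤ X := le_trans (le_max_left _ _) hX
  have hXD : (D : ℝ) ≤ X := le_trans (le_trans (le_max_left _ _) (le_max_right _ _)) hX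
  have hX16 : (16 : ℝ) ≤ X := le_trans (le_trans (le_max_right _ _) (le_max_right _ _)) hX
  have hXDn : D ≤ X := by exact_mod_cast hXD
  have hX0 : (0 : ℝ) < X := by linarith
  set t : ℝ := Real.log X with ht
  have ht2 : 2 ≤ t := by
    rw [ht, Real.le_log_iff_exp_le hX0]
    have h1 := Real.exp_one_lt_d9
    have h2 : Real.exp 2 = Real.exp 1 * Real.exp 1 := by rw [← Real.exp_add]; norm_num
    rw [h2]
    nlinarith [Real.exp_pos 1]
  have ht1 : 1 ≤ t := by linarith
  have hH1 : (1 : ℝ) ≤ H := le_trans (Real.one_le_rpow ht1 (by positivity)) hHlow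
  have hH1n : 1 ≤ H := by exact_mod_cast hH1
  have hHXn : H ≤ X := by exact_mod_cast hHX
  -- the weights
  set F : ℕ → ℝ := fun n => ∏ a ∈ A, Λ (n + a) with hF
  have hF0 : ∀ n, 0 ≤ F n := fun n => Finset.prod_nonneg fun a _ => ArithmeticFunction.vonMangoldt_nonneg
  set w : ℕ → ℂ := fun n => if n ∈ Icc 1 X then b n * ∏ a ∈ A, (Λ (n + a) : ℂ) else 0 with hw
  have hwF : ∀ n, ‖w n‖ ≤ F n := by
    intro n
    simp only [hw]
    split_ifs
    · rw [norm_mul, norm_prod]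
      calc ‖b n‖ * ∏ a ∈ A, ‖(Λ (n + a) : ℂ)‖ ≤ 1 * ∏ a ∈ A, ‖(Λ (n + a) : ℂ)‖ :=
            mul_le_mul_of_nonneg_right (hb n) (Finset.prod_nonneg fun _ _ => norm_nonneg _)
        _ = F n := by
            rw [one_mul, hF]
            refine Finset.prod_congr rfl fun a _ => ?_
            rw [Complex.norm_real, Real.norm_of_nonneg ArithmeticFunction.vonMangoldt_nonneg]
    · rw [norm_zero]; exact hF0 n
  have hwsupp : ∀ n, w n ≠ 0 → n ∈ Icc 1 X := by
    intro n hn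
    by_contra h
    exact hn (by simp only [hw, if_neg h])
  set v₁ : ℕ → ℝ := fun n => ‖w n‖ with hv₁
  set v₂ : ℕ → ℝ := fun m' => if 2 * H < m' then v₁ (m' - 2 * H) else 0 with hv₂
  set Λv : ℕ → ℝ := fun m' => if 2 * H < m' then F (m' - 2 * H) else 0 with hΛv
  have hv₂0 : ∀ n, 0 ≤ v₂ n := fun n => by
    simp only [hv₂]; split_ifs
    · exact norm_nonneg _
    · exact le_rfl
  have hΛv0 : ∀ n, 0 ≤ Λv n := fun n => by
    simp only [hΛv]; split_ifs
    · exact hF0 _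
    · exact le_rfl
  have hvΛ : ∀ n, v₂ n ≤ Λv n := fun n => by
    simp only [hv₂, hΛv]; split_ifs
    · exact hwF _
    · exact le_rfl
  set X'' : ℕ := X + 2 * H with hX''
  have hsupp : ∀ n, v₂ n ≠ 0 → 2 * H ≤ n ∧ n ≤ X'' := by
    intro n hn
    simp only [hv₂, hv₁] at hn
    split_ifs at hn with h
    · have h2 := hwsupp (n - 2 * H) (fun h0 => hn (by rw [h0, norm_zero]))
      rw [Finset.mem_Icc] at h2
      constructor <;> omega
    · exact absurd rfl hn
  -- Step 1: `∫ ∑ = ∑ ∫` and the expansion of each moment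
  set S : ℕ → ℝ → ℂ := fun k α => ∑ n ∈ Ioc (k - 2 * H) k, w n * (𝐞 (-((n : ℝ) * α)) : ℂ) with hS
  have hSc : ∀ k, Continuous (S k) := fun k => continuous_windowSum _ _
  have hint : ∀ k ∈ Icc 1 (X + 2 * H),
      IntervalIntegrable (fun α => ‖S k α‖ ^ (2 * j)) volume 0 1 := fun k _ =>
    (((hSc k).norm).pow _).intervalIntegrable 0 1
  rw [intervalIntegral.integral_finsetSum hint]
  set bal : (Fin j → ℕ) × (Fin j → ℕ) → Prop := fun p => ∑ i, p.1 i = ∑ i, p.2 i with hbal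
  set Pk : ℕ → Finset ((Fin j → ℕ) × (Fin j → ℕ)) := fun k =>
    (Fintype.piFinset fun _ : Fin j => Ioc (k - 2 * H) k) ×ˢ
      (Fintype.piFinset fun _ : Fin j => Ioc (k - 2 * H) k) with hPk
  have step1 : ∀ k, ∫ α in (0 : ℝ)..1, ‖S k α‖ ^ (2 * j) ≤
      ∑ p ∈ (Pk (k + 2 * H)).filter bal, (∏ i, v₂ (p.1 i)) * ∏ i, v₂ (p.2 i) := by
    intro k
    refine (integral_norm_pow_le_sum_balanced (Ioc (k - 2 * H) k) w v₁ (fun n => le_rfl) j).trans ?_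
    exact sum_balanced_shift_le k H j v₁ (fun n => norm_nonneg _)
  -- Step 2: shift the windows and pass to base point × pattern
  set g : ℕ → ℝ := fun k' => ∑ p ∈ (Pk k').filter bal, (∏ i, v₂ (p.1 i)) * ∏ i, v₂ (p.2 i)
    with hg
  have hg0 : ∀ k', 0 ≤ g k' := fun k' => Finset.sum_nonneg fun p _ =>
    mul_nonneg (Finset.prod_nonneg fun i _ => hv₂0 _) (Finset.prod_nonneg fun i _ => hv₂0 _)
  have step2 : ∑ k ∈ Icc 1 (X + 2 * H), ∫ α in (0 : ℝ)..1, ‖S k α‖ ^ (2 * j) ≤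
      ∑ k' ∈ Icc 1 (X'' + 2 * H), g k' := by
    calc ∑ k ∈ Icc 1 (X + 2 * H), ∫ α in (0 : ℝ)..1, ‖S k α‖ ^ (2 * j)
        ≤ ∑ k ∈ Icc 1 (X + 2 * H), g (k + 2 * H) := Finset.sum_le_sum fun k _ => step1 k
      _ ≤ ∑ k' ∈ Icc 1 (X'' + 2 * H), g k' := by
          refine sum_le_sum_of_injOn_nn _ _ (fun k => k + 2 * H) _ _ (fun k _ k' _ h => by
            simpa using h) (fun k hk => ?_) (fun k' _ => hg0 k') (fun k _ => le_rfl)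
          rw [Finset.mem_Icc] at hk ⊢; rw [hX'']; omega
  set E : Finset ((Fin j → ℕ) × (Fin j → ℕ)) :=
    ((Fintype.piFinset fun _ : Fin j => Icc 1 (4 * H - 1)) ×ˢ
      (Fintype.piFinset fun _ : Fin j => Icc 1 (4 * H - 1))).filter
        (fun e => ∑ i, e.1 i = ∑ i, e.2 i ∧ e.2 ⟨j - 1, by omega⟩ = 2 * H) with hE
  have step3 : ∑ k' ∈ Icc 1 (X'' + 2 * H), g k' ≤
      (2 * H : ℝ) * ∑ q ∈ (range (X'' + 1)) ×ˢ E,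
        (∏ i, Λv (q.1 + q.2.1 i)) * ∏ i, Λv (q.1 + q.2.2 i) :=
    sum_windows_le_line X'' H j hj1 v₂ Λv hv₂0 hΛv0 hvΛ hsupp
  -- Step 3: each pattern
  set N : ℕ := X'' + 4 * H + D with hN
  set LN : ℝ := Real.log N with hLN
  set cnt : (Fin j → ℕ) × (Fin j → ℕ) → ℕ := fun ee =>
    #(leaders (D : ℤ) (fun k => ((Fin.append ee.1 ee.2 k : ℕ) : ℤ))) with hcnt
  have hNX : X ≤ N := by rw [hN, hX'']; omega
  have hN0c : X₀c ≤ N := le_trans (by exact_mod_cast hXc) hNX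
  have hNr : (N : ℝ) ≤ 4 * ((X'' : ℕ) : ℝ) := by
    rw [hN, hX'']; push_cast
    have : (D : ℝ) ≤ X := hXD
    nlinarith
  have hN1 : (1 : ℝ) < N := by
    have : (16 : ℝ) ≤ N := hX16.trans (by exact_mod_cast hNX)
    linarith
  have hLN1 : 1 ≤ LN := by
    rw [hLN]
    have : t ≤ Real.log N := Real.log_le_log hX0 (by exact_mod_cast hNX)
    linarith
  have hLN2t : LN ≤ 2 * t := by
    have h8 : (N : ℝ) ≤ 8 * X := by
      rw [hN, hX'']; push_cast; nlinarith
    calc LN ≤ Real.log (8 * X) := Real.log_le_log (by linarith) h8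
      _ = Real.log 8 + t := by rw [Real.log_mul (by norm_num) hX0.ne']
      _ ≤ t + t := by
          have : Real.log 8 ≤ t := by
            rw [ht]; exact Real.log_le_log (by norm_num) (by linarith)
          linarith
      _ = 2 * t := by ring
  have hLLN : Real.log LN ≤ 2 * Real.log t := by
    calc Real.log LN ≤ Real.log (2 * t) := Real.log_le_log (by linarith) hLN2t
      _ = Real.log 2 + Real.log t := Real.log_mul (by norm_num) (by linarith)
      _ ≤ Real.log t + Real.log t := by
          have : Real.log 2 ≤ Real.log t := Real.log_le_log (by norm_num) ht2
          linarith
      _ = 2 * Real.log t := by ring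
  have hLLN0 : 0 ≤ Real.log LN := Real.log_nonneg hLN1
  have hpat : ∀ ee ∈ E, ∑ n ∈ range (X'' + 1), (∏ i, Λv (n + ee.1 i)) * ∏ i, Λv (n + ee.2 i) ≤
      Cc * N * Real.log LN ^ M * LN ^ (M - ℓ * cnt ee) := by
    intro ee hee
    rw [hE, Finset.mem_filter] at hee
    obtain ⟨hbox, -, hpin⟩ := hee
    simp only [Finset.mem_product, Fintype.mem_piFinset, Finset.mem_Icc] at hbox
    set z : Fin (j + j) → ℕ := Fin.append ee.1 ee.2 with hz
    have hzb : ∀ k, 1 ≤ z k ∧ z k ≤ 4 * H - 1 := by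
      intro k
      refine Fin.addCases (fun i => ?_) (fun i => ?_) k
      · rw [hz, Fin.append_left]; exact hbox.1 i
      · rw [hz, Fin.append_right]; exact hbox.2 i
    obtain ⟨i₀, -, hi₀⟩ := Finset.exists_min_image univ z ⟨Fin.natAdd j ⟨j - 1, by omega⟩, Finset.mem_univ _⟩
    have hi₀' : ∀ i, z i₀ ≤ z i := fun i => hi₀ i (Finset.mem_univ _)
    have hzH : z i₀ ≤ 2 * H := by
      have h1 := hi₀' (Fin.natAdd j ⟨j - 1, by omega⟩)
      rw [hz, Fin.append_right, hpin] at h1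
      exact h1
    -- rewrite the pattern sum through `z`
    have hre : ∀ n, (∏ i, Λv (n + ee.1 i)) * ∏ i, Λv (n + ee.2 i) =
        ∏ k : Fin (j + j), (if 2 * H < n + z k then F (n + z k - 2 * H) else 0) := by
      intro n
      rw [hz, prod_append_eq ee.1 ee.2 (fun r => Λv (n + r))]
    simp_rw [hre]
    have h1 : ∑ n ∈ range (X'' + 1), ∏ k : Fin (j + j), (if 2 * H < n + z k then F (n + z k - 2 * H) else 0) ≤
        ∑ n ∈ range (N + 1), ∏ k : Fin (j + j), (if 2 * H < n + z k then F (n + z k - 2 * H) else 0) := by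
      refine Finset.sum_le_sum_of_subset_of_nonneg (fun n hn => ?_) (fun n _ _ => ?_)
      · rw [Finset.mem_range] at hn ⊢; omega
      · exact Finset.prod_nonneg fun k _ => by split_ifs; exacts [hF0 _, le_rfl]
    refine h1.trans ?_
    have h2 := hcrude N H A z i₀ hN0c (by rw [hM, hm]) hi₀' hzH hA (fun i a ha => by
      have := (hzb i).2; have := hAD a ha; rw [hN]; omega)
    refine h2.trans ?_
    -- `s ≥ ℓ · cnt`
    have hs : ℓ * cnt ee ≤ #((univ ×ˢ (A.map Nat.castEmbedding)).image
        fun p : Fin (j + j) × ℤ => (z p.1 : ℤ) + p.2) := by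
      have := card_mul_card_leaders_le Aℤ (D : ℤ) hAℤD (fun k => (z k : ℤ))
      rw [hAℤcard] at this
      exact this
    refine mul_le_mul_of_nonneg_left (pow_le_pow_right₀ hLN1 (by omega)) (by positivity)
  -- Step 4: sum over patterns, fiberwise in the number of leaders
  have hcntmem : ∀ ee ∈ E, cnt ee ∈ Icc 1 m := fun ee _ => card_leaders_mem_Icc (by omega) _ _
  have hcount : ∑ ee ∈ E, LN ^ (M - ℓ * cnt ee) ≤ (m : ℝ) * (CT * 2 ^ M * 4 ^ m * (H : ℝ) ^ (m - 2)) := by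
    rw [← Finset.sum_fiberwise_of_maps_to hcntmem]
    have hterm : ∀ c ∈ Icc 1 m, ∑ ee ∈ E with cnt ee = c, LN ^ (M - ℓ * cnt ee) ≤
        CT * 2 ^ M * 4 ^ m * (H : ℝ) ^ (m - 2) := by
      intro c hc
      rw [Finset.mem_Icc] at hc
      have h1 : ∑ ee ∈ E with cnt ee = c, LN ^ (M - ℓ * cnt ee) =
          #(E.filter fun ee => cnt ee = c) * LN ^ (M - ℓ * c) := by
        rw [Finset.sum_congr rfl fun ee hee => by rw [(Finset.mem_filter.1 hee).2],
          Finset.sum_const, nsmul_eq_mul]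
      rw [h1]
      have h2 : (#(E.filter fun ee => cnt ee = c) : ℝ) ≤
          CT * (4 * H : ℝ) ^ (c - 1 - if j + j < 2 * c then 1 else 0) := by
        have := hCT H c
        rw [hE] at *
        exact_mod_cast this
      have h3 : LN ^ (M - ℓ * c) ≤ 2 ^ M * t ^ (ℓ * (j + j - c)) := by
        have hMc : M - ℓ * c = ℓ * (j + j - c) := by
          obtain ⟨d, hd⟩ := Nat.exists_eq_add_of_le (show c ≤ j + j by omega)
          rw [hM, hm, hd, Nat.add_sub_cancel_left, add_mul, mul_comm c ℓ, Nat.add_sub_cancel_left,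
            mul_comm d ℓ]
        rw [hMc]
        calc LN ^ (ℓ * (j + j - c)) ≤ (2 * t) ^ (ℓ * (j + j - c)) :=
              pow_le_pow_left₀ (by linarith) hLN2t _
          _ = 2 ^ (ℓ * (j + j - c)) * t ^ (ℓ * (j + j - c)) := mul_pow _ _ _
          _ ≤ 2 ^ M * t ^ (ℓ * (j + j - c)) := by
              refine mul_le_mul_of_nonneg_right (pow_le_pow_right₀ (by norm_num) ?_) (by positivity)
              rw [hM, hm, mul_comm (j + j) ℓ]; exact Nat.mul_le_mul_left _ (Nat.sub_le _ _)
      have h4 := count_weight_le (ℓ := ℓ) (j := j) (c := c) hε hjε hc.1 hc.2 ht1 hH1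
        (by rw [ht]; exact_mod_cast hHlow)
      calc (#(E.filter fun ee => cnt ee = c) : ℝ) * LN ^ (M - ℓ * c)
          ≤ (CT * (4 * H : ℝ) ^ (c - 1 - if j + j < 2 * c then 1 else 0)) *
              (2 ^ M * t ^ (ℓ * (j + j - c))) :=
            mul_le_mul h2 h3 (by positivity) (by positivity)
        _ = CT * 2 ^ M * ((4 * H : ℝ) ^ (c - 1 - if j + j < 2 * c then 1 else 0) *
              t ^ (ℓ * (j + j - c))) := by ring
        _ ≤ CT * 2 ^ M * (4 ^ (j + j) * (H : ℝ) ^ (j + j - 2)) :=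
            mul_le_mul_of_nonneg_left h4 (by positivity)
        _ = CT * 2 ^ M * 4 ^ m * (H : ℝ) ^ (m - 2) := by rw [hm]; ring
    calc ∑ c ∈ Icc 1 m, ∑ ee ∈ E with cnt ee = c, LN ^ (M - ℓ * cnt ee)
        ≤ ∑ c ∈ Icc 1 m, CT * 2 ^ M * 4 ^ m * (H : ℝ) ^ (m - 2) := Finset.sum_le_sum hterm
      _ = (m : ℝ) * (CT * 2 ^ M * 4 ^ m * (H : ℝ) ^ (m - 2)) := by
          rw [Finset.sum_const, Nat.card_Icc, nsmul_eq_mul, Nat.add_sub_cancel]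
  -- Step 5: combine
  have step4 : ∑ q ∈ (range (X'' + 1)) ×ˢ E, (∏ i, Λv (q.1 + q.2.1 i)) * ∏ i, Λv (q.1 + q.2.2 i) ≤
      Cc * N * Real.log LN ^ M * ((m : ℝ) * (CT * 2 ^ M * 4 ^ m * (H : ℝ) ^ (m - 2))) := by
    rw [Finset.sum_product_right]
    calc ∑ ee ∈ E, ∑ n ∈ range (X'' + 1), (∏ i, Λv (n + ee.1 i)) * ∏ i, Λv (n + ee.2 i)
        ≤ ∑ ee ∈ E, Cc * N * Real.log LN ^ M * LN ^ (M - ℓ * cnt ee) := Finset.sum_le_sum hpat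
      _ = Cc * N * Real.log LN ^ M * ∑ ee ∈ E, LN ^ (M - ℓ * cnt ee) := by rw [Finset.mul_sum]
      _ ≤ Cc * N * Real.log LN ^ M * ((m : ℝ) * (CT * 2 ^ M * 4 ^ m * (H : ℝ) ^ (m - 2))) :=
          mul_le_mul_of_nonneg_left hcount (by positivity)
  have hX''r : ((X'' : ℕ) : ℝ) = ((X + 2 * H : ℕ) : ℝ) := by rw [hX'']
  have hX''0 : (0 : ℝ) < ((X'' : ℕ) : ℝ) := by rw [hX'']; push_cast; positivity
  have h2H : ((2 * H : ℕ) : ℝ) = 2 * H := by push_cast; ring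
  have hH0 : (0 : ℝ) < H := by linarith
  -- the final chain
  have hLLM : Real.log LN ^ M ≤ 2 ^ M * Real.log t ^ M := by
    rw [← mul_pow]; exact pow_le_pow_left₀ hLLN0 hLLN M
  have hlogt0 : 0 ≤ Real.log t := Real.log_nonneg ht1
  have hpowH : (2 * (H : ℝ)) * (H : ℝ) ^ (m - 2) * 2 ^ (2 * j - 1) ≤ 2 * ((2 * H : ℕ) : ℝ) ^ (2 * j - 1) := by
    refine le_of_eq ?_
    rw [h2H, mul_pow]
    have hm2 : m - 2 + 1 = 2 * j - 1 := by rw [hm]; omega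
    rw [← hm2, pow_succ, pow_succ]
    ring
  calc ∑ k ∈ Icc 1 (X + 2 * H), ∫ α in (0 : ℝ)..1, ‖S k α‖ ^ (2 * j)
      ≤ (2 * H : ℝ) * (Cc * N * Real.log LN ^ M * ((m : ℝ) * (CT * 2 ^ M * 4 ^ m * (H : ℝ) ^ (m - 2)))) :=
        step2.trans (step3.trans (mul_le_mul_of_nonneg_left step4 (by positivity)))
    _ ≤ (2 * H : ℝ) * (Cc * (4 * ((X'' : ℕ) : ℝ)) * (2 ^ M * Real.log t ^ M) *
          ((m : ℝ) * (CT * 2 ^ M * 4 ^ m * (H : ℝ) ^ (m - 2)))) := by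
        gcongr
    _ = (8 * Cc * m * CT * 4 ^ M * 4 ^ m) * Real.log t ^ M *
          ((2 * (H : ℝ)) * (H : ℝ) ^ (m - 2) * 2 ^ (2 * j - 1)) * ((X'' : ℕ) : ℝ) / 2 ^ (2 * j) := by
        have h4M : (4 : ℝ) ^ M = 2 ^ M * 2 ^ M := by rw [← mul_pow]; norm_num
        have h2j : (2 : ℝ) ^ (2 * j) = 2 * 2 ^ (2 * j - 1) := by
          rw [← pow_succ', Nat.sub_add_cancel (by omega : 1 ≤ 2 * j)]
        rw [h4M, h2j]
        field_simp
        ring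
    _ ≤ (8 * Cc * m * CT * 4 ^ M * 4 ^ m) * Real.log t ^ M *
          (2 * ((2 * H : ℕ) : ℝ) ^ (2 * j - 1)) * ((X'' : ℕ) : ℝ) / 2 ^ (2 * j) := by
        gcongr
    _ ≤ B * Real.log t ^ M * ((2 * H : ℕ) : ℝ) ^ (2 * j - 1) * ((X + 2 * H : ℕ) : ℝ) := by
        rw [← hX''r]
        have h22j : (2 : ℝ) ≤ 2 ^ (2 * j) := by
          calc (2 : ℝ) = 2 ^ 1 := (pow_one _).symm
            _ ≤ 2 ^ (2 * j) := pow_le_pow_right₀ (by norm_num) (by omega)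
        have hB' : 8 * Cc * m * CT * 4 ^ M * 4 ^ m ≤ B := by rw [hB]; linarith
        have hrest : 0 ≤ Real.log t ^ M * ((2 * H : ℕ) : ℝ) ^ (2 * j - 1) * ((X'' : ℕ) : ℝ) := by
          positivity
        rw [div_le_iff₀ (by positivity)]
        calc 8 * Cc * m * CT * 4 ^ M * 4 ^ m * Real.log t ^ M * (2 * ((2 * H : ℕ) : ℝ) ^ (2 * j - 1)) *
              ((X'' : ℕ) : ℝ)
            = (8 * Cc * m * CT * 4 ^ M * 4 ^ m) *
                (Real.log t ^ M * ((2 * H : ℕ) : ℝ) ^ (2 * j - 1) * ((X'' : ℕ) : ℝ)) * 2 := by ring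
          _ ≤ B * (Real.log t ^ M * ((2 * H : ℕ) : ℝ) ^ (2 * j - 1) * ((X'' : ℕ) : ℝ)) * 2 ^ (2 * j) :=
              mul_le_mul (mul_le_mul_of_nonneg_right hB' hrest) h22j (by norm_num) (by
                have : 0 ≤ B := by rw [hB]; positivity
                positivity)
          _ = B * Real.log t ^ M * ((2 * H : ℕ) : ℝ) ^ (2 * j - 1) * ((X'' : ℕ) : ℝ) * 2 ^ (2 * j) := by
              ring

end LichtmanTeravainen2022

end Literature.NumberTheory.Sieve
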